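import Summits.QuantumFields.YangMills.Theorems.SwapVirialDeficitSectorLaplaceTipCoreProfile
import HarnessLib

/-!
# THE TIP OF SKELETON ➎, THE CORE AGAINST THE BULK MAIN TERM FROM THE PROFILE CEILING (hCore) — concrete composition
# (cell ym-idea-1; free-hands support of ⟨stmt-QuantumFields-24197⟩ `SwapVirialDeficit.SwapGluedStiffness`; LEAD g100 01:29Z ∕ w3 g68 01:18Z «profile inside the
# p-integral»; g49's ✓`core_le_shell_of_pointwise₂` ∘ ✓`setIntegral_disc_le_of_pointwise` ∘ w2 g61's ✓`mbDensity_hubAt_comparable_profile` (shell oscillation)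
# ∘ w3 g68's ✓`shell_boxMass_le_mbMain`)

★★ `tipCore_le_mbMain_of_profile` — for good `ε`, `0 < τ ≤ (1+16δr²)⁻¹`, `0 < ρ₁ ≤ min 1 (ρO/4)`, a core cut `d ≥ 1`, `Φ, T ≥ 0`, `b ≥ 0`, and the per-hub PROFILE ceiling
(hCore) `I(hubAt δt 1, ε; b) ≤ Φ·((2π/b)^α·∫_p (1+δt²)²/(1+h(p)(1+δt²))·𝔪(hubAt δs 1, ε, p)) + T` for `δt > d`, `δs ∈ [δr, 2δr]`:
`coneConst·π·∫_{Ioi d}((1+δ²)⁻¹)²·I(hubAt δ 1) ≤ (Φ₁·d⁻¹ + Φ₂·(8/3)·d^{−3/4})/W′·M_ε + coneConst·π·T·d⁻¹` with `Φ₁ = Φ·(2π/b)^α·(2/ρ₁²)` (box `|p| ≥ ρ₁`: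
`Profile ≤ 2(1+δt²)/ρ₁²`) and `Φ₂ = Φ·(2π/b)^α·512·(1+2√½·ρ₁)^{1/4}·Osc/(ρO²/8)` (corner disc) — the `b`-RATES `d⁻¹`, `d^{−3/4}` of the core at `d = δ_b(b)`.

HONEST LABEL: composition bookkeeping; (hCore) (multi-seat: w3 g68, w2 g61, successors), `stub_core_tip`, ⟨24197⟩ ∕ ⟨24194⟩ OPEN; item of record ⟨24085⟩ `SubOctaveBounded`
aside ∕ untouched; the Yang–Mills mass gap is NOT proved; no summit is proved by a line.  THEOREMS ONLY (0 `def`, 0 `sorry`), standard axioms, no instances.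
Seat ym-line-fcl-p3 g49 (cell ym-idea-1, free hands = ➎ assembler), `--supports stmt-QuantumFields-24197`.  References: [cite: Luscher1983, §2]; [folklore].
-/

set_option autoImplicit false
set_option synthInstance.maxSize 1024

noncomputable section

open MeasureTheory Quaternion Set Module
open scoped Quaternion BigOperators ENNReal
open Literature.MathematicalPhysics.QuantumLattice
open Literature.MathematicalPhysics.QuantumFieldTheory hiding SU2
open Summit.QuantumFields.YangMills.Theorems.SwapTwistDeficit.ToronLog

namespace Summit.QuantumFields.YangMills.Theorems.SwapVirialDeficit.SectorLaplace

open Summit.QuantumFields.YangMills.Theorems.FemtoTransferGap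
open Summit.QuantumFields.YangMills.Theorems.FemtoTransferGap.TT
open Summit.QuantumFields.YangMills.Theorems.VirialFluxGap.RingDeficit
open Summit.QuantumFields.YangMills.Theorems.SwapVirialDeficit.SwapRing
open Summit.QuantumFields.YangMills.Theorems.SwapVirialDeficit.BlowUpRing

variable {L : ℕ} [NeZero L]

set_option maxHeartbeats 1600000 in
/-- ★★ **THE CORE OF THE TIP WEIGHS `b`-RATES OF THE BULK MAIN TERM, given the per-hub PROFILE ceiling (hCore).** [cite: Luscher1983, §2] -/
theorem tipCore_le_mbMain_of_profile {ε : GnoSign L} (hε : GoodSign ε) {τ : ℝ} (hτ : 0 < τ)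
    (hτw : τ ≤ (1 + 16 * (12 * 122689728 * 2304 * (Fintype.card (Fol L) : ℝ) ^ 2 * (L : ℝ) ^ 10) ^ 2)⁻¹)
    {ρ₀ : ℝ} (hρ₀ : 0 < ρ₀) (hρ₀1 : ρ₀ ≤ 1)
    (hρ₀O : ρ₀ ≤ (12 * (Fintype.card (Fol L) : ℝ) * 44712000 * (L : ℝ) ^ 4 * (2304 * (L : ℝ) ^ 6 * (Fintype.card (Fol L) : ℝ)))⁻¹ / 4)
    {d Φ T b : ℝ} (hd : 1 ≤ d) (hΦ : 0 ≤ Φ) (hT : 0 ≤ T) (hb : 0 ≤ b)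
    (H : ∀ δt ∈ Ioi d, ∀ δs ∈ Icc (12 * 122689728 * 2304 * (Fintype.card (Fol L) : ℝ) ^ 2 * (L : ℝ) ^ 10)
        (2 * (12 * 122689728 * 2304 * (Fintype.card (Fol L) : ℝ) ^ 2 * (L : ℝ) ^ 10)),
      hubIntegral (L := L) (hubAt δt 1) ε b ≤
        Φ * ((2 * Real.pi / b) ^ alpha L * ∫ p : ℝ × ℝ, ((1 + δt ^ 2) ^ 2 / (1 + (p.1 ^ 2 / (1 + p.1 ^ 2) + p.2 ^ 2 / (1 + p.2 ^ 2)) * (1 + δt ^ 2))) *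
          mbDensity (L := L) (hubAt δs 1) ε p) + T) :
    coneConst * Real.pi * ∫ δ in Ioi d, ((1 + δ ^ 2)⁻¹) ^ 2 * hubIntegral (L := L) (hubAt δ 1) ε b ≤
      (Φ * (2 * Real.pi / b) ^ alpha L * (2 / ρ₀ ^ 2) * d⁻¹ +
          Φ * (2 * Real.pi / b) ^ alpha L * (512 * (1 + 2 * Real.sqrt (1 / 2) * ρ₀) ^ (1 / 4 : ℝ) *
            ((Real.exp 1 * ((1 + (finrank ℝ (GnoFol L) : ℝ)) * (20400 * (L : ℝ) ^ 4)) ^ (7 / 2 : ℝ) *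
                (Real.sqrt ((1 / 4 : ℝ) * (1 / (1800 * (L : ℝ) ^ 6))) ^ 3)⁻¹ * (2 * (1800 * (L : ℝ) ^ 6) ^ 2)) *
              (1 + (2 * (12 * 122689728 * 2304 * (Fintype.card (Fol L) : ℝ) ^ 2 * (L : ℝ) ^ 10)) ^ 2) ^ 2 *
              (1 + ((12 * (Fintype.card (Fol L) : ℝ) * 44712000 * (L : ℝ) ^ 4 * (2304 * (L : ℝ) ^ 6 * (Fintype.card (Fol L) : ℝ)))⁻¹) ^ 2) ^ 2) /
            (((12 * (Fintype.card (Fol L) : ℝ) * 44712000 * (L : ℝ) ^ 4 * (2304 * (L : ℝ) ^ 6 * (Fintype.card (Fol L) : ℝ)))⁻¹) ^ 2 / 8)) *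
            (2 * (4 / 3) * d ^ (-(3 / 4 : ℝ)))) /
          (((2 * (12 * 122689728 * 2304 * (Fintype.card (Fol L) : ℝ) ^ 2 * (L : ℝ) ^ 10)) /
                (1 + (2 * (12 * 122689728 * 2304 * (Fintype.card (Fol L) : ℝ) ^ 2 * (L : ℝ) ^ 10)) ^ 2) -
              (12 * 122689728 * 2304 * (Fintype.card (Fol L) : ℝ) ^ 2 * (L : ℝ) ^ 10) /
                (1 + (12 * 122689728 * 2304 * (Fintype.card (Fol L) : ℝ) ^ 2 * (L : ℝ) ^ 10) ^ 2) +
              (Real.arctan (2 * (12 * 122689728 * 2304 * (Fintype.card (Fol L) : ℝ) ^ 2 * (L : ℝ) ^ 10)) -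
                Real.arctan (12 * 122689728 * 2304 * (Fintype.card (Fol L) : ℝ) ^ 2 * (L : ℝ) ^ 10))) / 2) *
        ((coneConst * Real.pi)⁻¹ * ∫ a in HubBulk τ, (∫ p : ℝ × ℝ, mbDensity (L := L) a ε p) ∂coneMeasure) * (coneConst * Real.pi) +
      coneConst * Real.pi * (T * d⁻¹) := by
  obtain ⟨hδr1, hρO0, hρO1, hwin1, hwin2⟩ := cornerWindow_facts (L := L)
  set n : ℝ := (Fintype.card (Fol L) : ℝ) with hn
  set δr : ℝ := 12 * 122689728 * 2304 * n ^ 2 * (L : ℝ) ^ 10 with hδr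
  set ρO : ℝ := (12 * n * 44712000 * (L : ℝ) ^ 4 * (2304 * (L : ℝ) ^ 6 * n))⁻¹ with hρO
  set R₀ : ℝ := Real.exp 1 * ((1 + (finrank ℝ (GnoFol L) : ℝ)) * (20400 * (L : ℝ) ^ 4)) ^ (7 / 2 : ℝ) *
      (Real.sqrt ((1 / 4 : ℝ) * (1 / (1800 * (L : ℝ) ^ 6))) ^ 3)⁻¹ * (2 * (1800 * (L : ℝ) ^ 6) ^ 2) with hR₀
  set μ : ℝ := (2304 * (L : ℝ) ^ 6 * n)⁻¹ with hμ
  set δ₁ : ℝ := Real.sqrt (τ⁻¹ - 1) with hδ₁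
  set D : Set (ℝ × ℝ) := {p : ℝ × ℝ | p.1 ^ 2 + p.2 ^ 2 < ρ₀ ^ 2} with hDdef
  set Box : Set (ℝ × ℝ) := {p : ℝ × ℝ | ρ₀ ^ 2 ≤ p.1 ^ 2 + p.2 ^ 2} with hBoxdef
  set A' : Set (ℝ × ℝ) := Icc ρ₀ (ρO / 2) ×ˢ Icc 0 (ρO / 2) with hA'def
  have hL1 : (1 : ℝ) ≤ L := by exact_mod_cast NeZero.one_le
  have hcc : 0 < coneConst * Real.pi := mul_pos coneConst_pos Real.pi_pos
  have hR₀0 : 0 < R₀ := by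
    rw [hR₀]
    have h1 : 0 < Real.sqrt ((1 / 4 : ℝ) * (1 / (1800 * (L : ℝ) ^ 6))) := Real.sqrt_pos.2 (by positivity)
    positivity
  have hδr0 : 0 < δr := by linarith
  -- the window: `τ ≤ 1/(1+16δr²) ≤ 1/2`, `c = 2δr ≤ δ₁`, shell inside the bulk window
  have hτ1 : τ ≤ 1 := hτw.trans (inv_le_one_of_one_le₀ (le_add_of_nonneg_right (by positivity)))
  have hc2 : (2 * δr) ^ 2 ≤ τ⁻¹ - 1 := by
    have h1 : 1 + 16 * δr ^ 2 ≤ τ⁻¹ := by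
      rw [le_inv_comm₀ (by positivity) hτ]; exact hτw
    have e : (2 * δr) ^ 2 = 4 * δr ^ 2 := by ring
    rw [e]; linarith [sq_nonneg δr]
  have hδ₁c : 2 * δr ≤ δ₁ := by
    rw [hδ₁, ← Real.sqrt_sq (by positivity : (0:ℝ) ≤ 2 * δr)]
    exact Real.sqrt_le_sqrt hc2
  have hδ₁0 : 0 < δ₁ := lt_of_lt_of_le (by positivity) hδ₁c
  have hshell : Icc δr (2 * δr) ⊆ {δ : ℝ | τ ≤ 4 * δ ^ 2 / (1 + δ ^ 2) ^ 2 ∧ τ ≤ (1 + δ ^ 2)⁻¹} := Icc_subset_bulkWindow hτ hδr1 hc2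
  -- the reference square `A'`
  have hA'm : MeasurableSet A' := measurableSet_Icc.prod measurableSet_Icc
  have hρO4 : ρ₀ ≤ ρO / 4 := hρ₀O
  have hA'B : A' ⊆ Box := by
    intro p hp
    rw [hA'def] at hp
    obtain ⟨⟨h1, -⟩, -⟩ := hp
    show ρ₀ ^ 2 ≤ p.1 ^ 2 + p.2 ^ 2
    exact le_add_of_le_of_nonneg (pow_le_pow_left₀ hρ₀.le h1 2) (sq_nonneg _)
  have hA'vol : volume.real A' = (ρO / 2 - ρ₀) * (ρO / 2) := by
    rw [hA'def, Measure.volume_eq_prod, measureReal_prod_prod, Real.volume_real_Icc_of_le (by linarith), Real.volume_real_Icc_of_le (by linarith)]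
    ring
  have hA'fin : volume A' < ⊤ := by
    rw [hA'def, Measure.volume_eq_prod, Measure.prod_prod]; exact ENNReal.mul_lt_top measure_Icc_lt_top measure_Icc_lt_top
  have hV : 0 < ρO ^ 2 / 8 := by positivity
  have hVA : ρO ^ 2 / 8 ≤ volume.real A' := by
    rw [hA'vol]
    have h1 : ρO / 4 ≤ ρO / 2 - ρ₀ := by linarith
    calc ρO ^ 2 / 8 = (ρO / 4) * (ρO / 2) := by ring
      _ ≤ (ρO / 2 - ρ₀) * (ρO / 2) := mul_le_mul_of_nonneg_right h1 (by positivity)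
  have hwinδr : ∀ p p' : ℝ × ℝ, dist p p' ≤ ρO →
      (122689728 * δr⁻¹ + 44712000 * ‖(gnoBase p.1 p.2 : GnoCoord L) - gnoBase p'.1 p'.2‖) * (L : ℝ) ^ 4 ≤ μ / (2 * (3 * n)) := by
    intro p p' hd
    have h1 := hwin1
    have h2 := hwin2 _ ((norm_gnoBase_sub_le (L := L) p p').trans hd)
    rw [add_mul]
    linarith
  -- the oscillation on the shell (hOsc): `Osc = R₀(1+(2δr)²)²(1+ρO²)²`
  have hOsc : ∀ δs ∈ Icc δr (2 * δr), ∀ p : ℝ × ℝ, p.1 ^ 2 + p.2 ^ 2 < ρ₀ ^ 2 → ∀ p' ∈ A',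
      mbDensity (L := L) (hubAt δs 1) ε p ≤ (R₀ * (1 + (2 * δr) ^ 2) ^ 2 * (1 + ρO ^ 2) ^ 2) * mbDensity (L := L) (hubAt δs 1) ε p' := by
    intro δs hδs p hp p' hp'
    rw [hA'def] at hp'
    obtain ⟨⟨hp1a, hp1b⟩, ⟨hp2a, hp2b⟩⟩ := hp'
    -- the distance `dist p p' ≤ ρO`
    have hx : |p.1| ≤ ρ₀ := by
      have h := sq_le_sq.1 (show p.1 ^ 2 ≤ ρ₀ ^ 2 by linarith [sq_nonneg p.2]); rwa [abs_of_nonneg hρ₀.le] at h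
    have hy : |p.2| ≤ ρ₀ := by
      have h := sq_le_sq.1 (show p.2 ^ 2 ≤ ρ₀ ^ 2 by linarith [sq_nonneg p.1]); rwa [abs_of_nonneg hρ₀.le] at h
    have hd : dist p p' ≤ ρO := by
      rw [Prod.dist_eq, Real.dist_eq, Real.dist_eq]
      refine max_le ?_ ?_
      · have := abs_le.1 hx; rw [abs_le]; constructor <;> linarith
      · have := abs_le.1 hy; rw [abs_le]; constructor <;> linarith
    have hw := hwinδr p p' hd
    have h := mbDensity_hubAt_comparable_profile (L := L) hε hδr1 hδs.1 hδs.1 p p' hw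
    have hms0 : 0 ≤ mbDensity (L := L) (hubAt δs 1) ε p' := mbDensity_nonneg _ ε p'
    have hT0 : 0 < 1 + δs ^ 2 := by positivity
    have hfrac : (1 + δs ^ 2) ^ 2 / (1 + (p.1 ^ 2 / (1 + p.1 ^ 2) + p.2 ^ 2 / (1 + p.2 ^ 2)) * (1 + δs ^ 2)) ≤ (1 + (2 * δr) ^ 2) ^ 2 := by
      have hh0 : 0 ≤ p.1 ^ 2 / (1 + p.1 ^ 2) + p.2 ^ 2 / (1 + p.2 ^ 2) := by positivity
      have h1 : (1 + δs ^ 2) ^ 2 / (1 + (p.1 ^ 2 / (1 + p.1 ^ 2) + p.2 ^ 2 / (1 + p.2 ^ 2)) * (1 + δs ^ 2)) ≤ (1 + δs ^ 2) ^ 2 :=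
        div_le_self (by positivity) (le_add_of_nonneg_right (mul_nonneg hh0 hT0.le))
      have h2 : (1 + δs ^ 2) ^ 2 ≤ (1 + (2 * δr) ^ 2) ^ 2 := by
        have : δs ^ 2 ≤ (2 * δr) ^ 2 := pow_le_pow_left₀ (by linarith [hδs.1]) hδs.2 2
        exact pow_le_pow_left₀ (by positivity) (by linarith) 2
      exact h1.trans h2
    have hwt : (1 + p'.1 ^ 2) * (1 + p'.2 ^ 2) / ((1 + p.1 ^ 2) * (1 + p.2 ^ 2)) ≤ (1 + ρO ^ 2) ^ 2 := by
      have h1 : (1 + p'.1 ^ 2) * (1 + p'.2 ^ 2) / ((1 + p.1 ^ 2) * (1 + p.2 ^ 2)) ≤ (1 + p'.1 ^ 2) * (1 + p'.2 ^ 2) :=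
        div_le_self (by positivity) (one_le_mul_of_one_le_of_one_le (le_add_of_nonneg_right (sq_nonneg p.1)) (le_add_of_nonneg_right (sq_nonneg p.2)))
      have h2 : p'.1 ^ 2 ≤ ρO ^ 2 := pow_le_pow_left₀ (hρ₀.le.trans hp1a) (hp1b.trans (by linarith)) 2
      have h3 : p'.2 ^ 2 ≤ ρO ^ 2 := pow_le_pow_left₀ hp2a (hp2b.trans (by linarith)) 2
      have h4 : (1 + p'.1 ^ 2) * (1 + p'.2 ^ 2) ≤ (1 + ρO ^ 2) ^ 2 := by
        calc (1 + p'.1 ^ 2) * (1 + p'.2 ^ 2) ≤ (1 + ρO ^ 2) * (1 + ρO ^ 2) := mul_le_mul (by linarith) (by linarith) (by positivity) (by positivity)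
          _ = (1 + ρO ^ 2) ^ 2 := by ring
      exact h1.trans h4
    calc mbDensity (L := L) (hubAt δs 1) ε p
        ≤ R₀ * ((1 + δs ^ 2) ^ 2 / (1 + (p.1 ^ 2 / (1 + p.1 ^ 2) + p.2 ^ 2 / (1 + p.2 ^ 2)) * (1 + δs ^ 2))) *
            ((1 + p'.1 ^ 2) * (1 + p'.2 ^ 2) / ((1 + p.1 ^ 2) * (1 + p.2 ^ 2))) * mbDensity (L := L) (hubAt δs 1) ε p' := h
      _ = R₀ * (((1 + δs ^ 2) ^ 2 / (1 + (p.1 ^ 2 / (1 + p.1 ^ 2) + p.2 ^ 2 / (1 + p.2 ^ 2)) * (1 + δs ^ 2))) *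
            ((1 + p'.1 ^ 2) * (1 + p'.2 ^ 2) / ((1 + p.1 ^ 2) * (1 + p.2 ^ 2)))) * mbDensity (L := L) (hubAt δs 1) ε p' := by ring
      _ ≤ R₀ * ((1 + (2 * δr) ^ 2) ^ 2 * (1 + ρO ^ 2) ^ 2) * mbDensity (L := L) (hubAt δs 1) ε p' :=
          mul_le_mul_of_nonneg_right (mul_le_mul_of_nonneg_left (mul_le_mul hfrac hwt (by positivity) (by positivity)) hR₀0.le) hms0
      _ = R₀ * (1 + (2 * δr) ^ 2) ^ 2 * (1 + ρO ^ 2) ^ 2 * mbDensity (L := L) (hubAt δs 1) ε p' := by ring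
  -- integrability along the shell and the plane-mass currency
  have hτ2 : τ ≤ 1 / 2 := by
    have h16 : (16 : ℝ) ≤ 16 * δr ^ 2 := by nlinarith
    have : (1 + 16 * δr ^ 2)⁻¹ ≤ (2 : ℝ)⁻¹ := by
      apply inv_anti₀ (by norm_num); linarith
    linarith [hτw.trans this]
  have hPint : ∀ δs ∈ Icc δr (2 * δr), Integrable fun p : ℝ × ℝ => mbDensity (L := L) (hubAt δs 1) ε p :=
    fun δs hδs => integrable_mbDensity_hubAt_of_window hε hτ hτ1 (hshell hδs)
  set P : ℝ → ℝ := fun δs => ∫ p : ℝ × ℝ, mbDensity (L := L) (hubAt δs 1) ε p with hPdef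
  have hP0 : ∀ δ, 0 ≤ P δ := fun δ => integral_nonneg fun p => mbDensity_nonneg _ ε p
  -- Step A: shell value at a corner point ≤ Osc/V · plane mass
  set Osc : ℝ := R₀ * (1 + (2 * δr) ^ 2) ^ 2 * (1 + ρO ^ 2) ^ 2 with hOscdef
  have hOsc0 : 0 ≤ Osc := by rw [hOscdef]; exact mul_nonneg (mul_nonneg hR₀0.le (by positivity)) (by positivity)
  have hA : ∀ δs ∈ Icc δr (2 * δr), ∀ p : ℝ × ℝ, p.1 ^ 2 + p.2 ^ 2 < ρ₀ ^ 2 → mbDensity (L := L) (hubAt δs 1) ε p * (ρO ^ 2 / 8) ≤ Osc * P δs := by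
    intro δs hδs p hp
    have hm0 : 0 ≤ mbDensity (L := L) (hubAt δs 1) ε p := mbDensity_nonneg _ ε p
    have hIA : IntegrableOn (fun p' : ℝ × ℝ => mbDensity (L := L) (hubAt δs 1) ε p') A' := (hPint δs hδs).integrableOn
    have hconst : IntegrableOn (fun _ : ℝ × ℝ => mbDensity (L := L) (hubAt δs 1) ε p) A' := (integrableOn_const_iff (by simp)).2 (Or.inr hA'fin)
    have h1 : ∫ _ in A', mbDensity (L := L) (hubAt δs 1) ε p ≤ ∫ p' in A', Osc * mbDensity (L := L) (hubAt δs 1) ε p' :=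
      setIntegral_mono_on hconst (hIA.const_mul Osc) hA'm (fun p' hp' => by rw [hOscdef]; exact hOsc δs hδs p hp p' hp')
    rw [setIntegral_const, smul_eq_mul, integral_const_mul] at h1
    have h2 : ∫ p' in A', mbDensity (L := L) (hubAt δs 1) ε p' ≤ P δs :=
      setIntegral_le_integral (hPint δs hδs) (Filter.Eventually.of_forall fun p => mbDensity_nonneg _ ε p)
    calc mbDensity (L := L) (hubAt δs 1) ε p * (ρO ^ 2 / 8) ≤ mbDensity (L := L) (hubAt δs 1) ε p * volume.real A' := mul_le_mul_of_nonneg_left hVA hm0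
      _ = volume.real A' * mbDensity (L := L) (hubAt δs 1) ε p := mul_comm _ _
      _ ≤ Osc * ∫ p' in A', mbDensity (L := L) (hubAt δs 1) ε p' := h1
      _ ≤ Osc * P δs := mul_le_mul_of_nonneg_left h2 hOsc0
  -- the box and the disc per hub pair
  have hBoxm : MeasurableSet Box := by rw [hBoxdef]; exact measurableSet_le measurable_const (by fun_prop)
  have hcompl : Boxᶜ = D := by
    ext p; simp only [hBoxdef, hDdef, mem_compl_iff, mem_setOf_eq, not_le]
  set X : ℝ := (1 + 2 * Real.sqrt (1 / 2) * ρ₀) ^ (1 / 4 : ℝ) with hXdef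
  have hX0 : 0 ≤ X := Real.rpow_nonneg (by positivity) _
  have hG0 : 0 ≤ (2 * Real.pi / b) ^ alpha L := Real.rpow_nonneg (div_nonneg (by positivity) hb) _
  have hper : ∀ δt ∈ Ioi d, ∀ δs ∈ Icc δr (2 * δr),
      ∫ p : ℝ × ℝ, ((1 + δt ^ 2) ^ 2 / (1 + (p.1 ^ 2 / (1 + p.1 ^ 2) + p.2 ^ 2 / (1 + p.2 ^ 2)) * (1 + δt ^ 2))) * mbDensity (L := L) (hubAt δs 1) ε p ≤
        ((2 / ρ₀ ^ 2) * (1 + δt ^ 2) + (512 * X * Osc / (ρO ^ 2 / 8)) * ((1 + δt ^ 2) * (1 + δt ^ 2) ^ (1 / 8 : ℝ))) * P δs := by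
    intro δt hδt δs hδs
    have hT1 : (1 : ℝ) ≤ 1 + δt ^ 2 := by nlinarith [sq_nonneg δt]
    have hT0 : 0 < 1 + δt ^ 2 := by positivity
    set prof : ℝ × ℝ → ℝ := fun p => (1 + δt ^ 2) ^ 2 / (1 + (p.1 ^ 2 / (1 + p.1 ^ 2) + p.2 ^ 2 / (1 + p.2 ^ 2)) * (1 + δt ^ 2)) with hprof
    have hh0 : ∀ p : ℝ × ℝ, 0 ≤ p.1 ^ 2 / (1 + p.1 ^ 2) + p.2 ^ 2 / (1 + p.2 ^ 2) := fun p => by positivity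
    have hprof0 : ∀ p, 0 ≤ prof p := fun p => by rw [hprof]; positivity
    have hprofT : ∀ p, prof p ≤ (1 + δt ^ 2) ^ 2 := fun p => by
      rw [hprof]; exact div_le_self (by positivity) (le_add_of_nonneg_right (mul_nonneg (hh0 p) hT0.le))
    -- integrability of `prof·𝔪`
    have hfm : AEStronglyMeasurable (fun p : ℝ × ℝ => prof p * mbDensity (L := L) (hubAt δs 1) ε p) volume := by
      have h1 : Measurable prof := by rw [hprof]; fun_prop
      exact (h1.aestronglyMeasurable).mul (hPint δs hδs).aestronglyMeasurable
    have hfi : Integrable (fun p : ℝ × ℝ => prof p * mbDensity (L := L) (hubAt δs 1) ε p) := by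
      refine Integrable.mono' ((hPint δs hδs).const_mul ((1 + δt ^ 2) ^ 2)) hfm (Filter.Eventually.of_forall fun p => ?_)
      rw [Real.norm_eq_abs, abs_of_nonneg (mul_nonneg (hprof0 p) (mbDensity_nonneg _ ε p))]
      exact mul_le_mul_of_nonneg_right (hprofT p) (mbDensity_nonneg _ ε p)
    -- split over Box / disc
    have hsplit := integral_add_compl hBoxm hfi
    rw [hcompl] at hsplit
    -- the box
    have hbox : ∫ p in Box, prof p * mbDensity (L := L) (hubAt δs 1) ε p ≤ (2 / ρ₀ ^ 2) * (1 + δt ^ 2) * P δs := by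
      have hpt : ∀ p ∈ Box, prof p * mbDensity (L := L) (hubAt δs 1) ε p ≤ (2 / ρ₀ ^ 2) * (1 + δt ^ 2) * mbDensity (L := L) (hubAt δs 1) ε p := by
        intro p hp
        refine mul_le_mul_of_nonneg_right ?_ (mbDensity_nonneg _ ε p)
        have hp' : ρ₀ ^ 2 ≤ p.1 ^ 2 + p.2 ^ 2 := hp
        -- `h(p) ≥ |p|²/(1+|p|²) ≥ ρ₀²/(1+ρ₀²) ≥ ρ₀²/2`
        have hh : ρ₀ ^ 2 / 2 ≤ p.1 ^ 2 / (1 + p.1 ^ 2) + p.2 ^ 2 / (1 + p.2 ^ 2) := by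
          have e1 : p.1 ^ 2 / (1 + p.1 ^ 2 + p.2 ^ 2) ≤ p.1 ^ 2 / (1 + p.1 ^ 2) :=
            div_le_div_of_nonneg_left (sq_nonneg _) (by positivity) (by linarith [sq_nonneg p.2])
          have e2 : p.2 ^ 2 / (1 + p.1 ^ 2 + p.2 ^ 2) ≤ p.2 ^ 2 / (1 + p.2 ^ 2) :=
            div_le_div_of_nonneg_left (sq_nonneg _) (by positivity) (by linarith [sq_nonneg p.1])
          have e3 : ρ₀ ^ 2 / 2 ≤ (p.1 ^ 2 + p.2 ^ 2) / (1 + p.1 ^ 2 + p.2 ^ 2) := by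
            rw [div_le_div_iff₀ (by norm_num) (by positivity)]
            have hρsq : ρ₀ ^ 2 ≤ 1 := pow_le_one₀ hρ₀.le hρ₀1
            have h4 := mul_le_mul_of_nonneg_right hρsq (add_nonneg (sq_nonneg p.1) (sq_nonneg p.2))
            linarith
          have e4 : (p.1 ^ 2 + p.2 ^ 2) / (1 + p.1 ^ 2 + p.2 ^ 2) = p.1 ^ 2 / (1 + p.1 ^ 2 + p.2 ^ 2) + p.2 ^ 2 / (1 + p.1 ^ 2 + p.2 ^ 2) := by ring
          linarith
        rw [hprof, div_le_iff₀ (by positivity)]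
        have hρ2 : 0 < ρ₀ ^ 2 := by positivity
        have key : (1 + δt ^ 2) ^ 2 ≤ 2 / ρ₀ ^ 2 * (1 + δt ^ 2) * ((ρ₀ ^ 2 / 2) * (1 + δt ^ 2)) := by
          have e : 2 / ρ₀ ^ 2 * (1 + δt ^ 2) * ((ρ₀ ^ 2 / 2) * (1 + δt ^ 2)) = (1 + δt ^ 2) ^ 2 := by field_simp
          rw [e]
        refine key.trans (mul_le_mul_of_nonneg_left ?_ (by positivity))
        have h5 := mul_le_mul_of_nonneg_right hh hT0.le
        linarith
      have hIbox : IntegrableOn (fun p : ℝ × ℝ => prof p * mbDensity (L := L) (hubAt δs 1) ε p) Box := hfi.integrableOn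
      calc ∫ p in Box, prof p * mbDensity (L := L) (hubAt δs 1) ε p ≤ ∫ p in Box, (2 / ρ₀ ^ 2) * (1 + δt ^ 2) * mbDensity (L := L) (hubAt δs 1) ε p :=
            setIntegral_mono_on hIbox ((hPint δs hδs).integrableOn.const_mul _) hBoxm hpt
        _ = (2 / ρ₀ ^ 2) * (1 + δt ^ 2) * ∫ p in Box, mbDensity (L := L) (hubAt δs 1) ε p := integral_const_mul _ _
        _ ≤ (2 / ρ₀ ^ 2) * (1 + δt ^ 2) * P δs :=
            mul_le_mul_of_nonneg_left (setIntegral_le_integral (hPint δs hδs) (Filter.Eventually.of_forall fun p => mbDensity_nonneg _ ε p)) (by positivity)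
    -- the disc
    have hM0 : 0 ≤ (1 + δt ^ 2) ^ 2 * (Osc * P δs / (ρO ^ 2 / 8)) := by
      have := hP0 δs; positivity
    have hdiscpt : ∀ p : ℝ × ℝ, p.1 ^ 2 + p.2 ^ 2 < ρ₀ ^ 2 →
        prof p * mbDensity (L := L) (hubAt δs 1) ε p * (1 + (1 / 2 : ℝ) * (p.1 ^ 2 + p.2 ^ 2) * (1 + δt ^ 2)) ≤ (1 + δt ^ 2) ^ 2 * (Osc * P δs / (ρO ^ 2 / 8)) := by
      intro p hp
      have hm0 : 0 ≤ mbDensity (L := L) (hubAt δs 1) ε p := mbDensity_nonneg _ ε p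
      have hρsq : ρ₀ ^ 2 ≤ 1 := pow_le_one₀ hρ₀.le hρ₀1
      have hx : p.1 ^ 2 ≤ 1 := by linarith [sq_nonneg p.2]
      have hy : p.2 ^ 2 ≤ 1 := by linarith [sq_nonneg p.1]
      have hh : (1 / 2 : ℝ) * (p.1 ^ 2 + p.2 ^ 2) ≤ p.1 ^ 2 / (1 + p.1 ^ 2) + p.2 ^ 2 / (1 + p.2 ^ 2) := by
        have e1 : p.1 ^ 2 / 2 ≤ p.1 ^ 2 / (1 + p.1 ^ 2) := div_le_div_of_nonneg_left (sq_nonneg _) (by positivity) (by linarith)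
        have e2 : p.2 ^ 2 / 2 ≤ p.2 ^ 2 / (1 + p.2 ^ 2) := div_le_div_of_nonneg_left (sq_nonneg _) (by positivity) (by linarith)
        linarith
      have hden0 : 0 < 1 + (p.1 ^ 2 / (1 + p.1 ^ 2) + p.2 ^ 2 / (1 + p.2 ^ 2)) * (1 + δt ^ 2) := by have := hh0 p; positivity
      -- `prof·(1+½|p|²T) ≤ T²`
      have hpr : prof p * (1 + (1 / 2 : ℝ) * (p.1 ^ 2 + p.2 ^ 2) * (1 + δt ^ 2)) ≤ (1 + δt ^ 2) ^ 2 := by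
        rw [hprof, div_mul_eq_mul_div, div_le_iff₀ hden0]
        have h3 := mul_le_mul_of_nonneg_right hh hT0.le
        exact mul_le_mul_of_nonneg_left (by linarith) (sq_nonneg _)
      have hmb : mbDensity (L := L) (hubAt δs 1) ε p ≤ Osc * P δs / (ρO ^ 2 / 8) := by
        rw [le_div_iff₀ hV]; exact hA δs hδs p hp
      calc prof p * mbDensity (L := L) (hubAt δs 1) ε p * (1 + (1 / 2 : ℝ) * (p.1 ^ 2 + p.2 ^ 2) * (1 + δt ^ 2))
          = (prof p * (1 + (1 / 2 : ℝ) * (p.1 ^ 2 + p.2 ^ 2) * (1 + δt ^ 2))) * mbDensity (L := L) (hubAt δs 1) ε p := by ring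
        _ ≤ (1 + δt ^ 2) ^ 2 * (Osc * P δs / (ρO ^ 2 / 8)) := mul_le_mul hpr hmb hm0 (by positivity)
    have hdisc := setIntegral_disc_le_of_pointwise (f := fun p : ℝ × ℝ => prof p * mbDensity (L := L) (hubAt δs 1) ε p)
      (κ := 1 / 2) (by norm_num) hT1 hM0 hρ₀.le hdiscpt
    -- assemble the per-hub bound
    have hdisc' : ∫ p in D, prof p * mbDensity (L := L) (hubAt δs 1) ε p ≤ (512 * X * Osc / (ρO ^ 2 / 8)) * ((1 + δt ^ 2) * (1 + δt ^ 2) ^ (1 / 8 : ℝ)) * P δs := by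
      refine hdisc.trans (le_of_eq ?_)
      rw [hXdef]
      have hne : (1 + δt ^ 2) ≠ 0 := hT0.ne'
      field_simp
      ring
    calc ∫ p : ℝ × ℝ, prof p * mbDensity (L := L) (hubAt δs 1) ε p
        = (∫ p in Box, prof p * mbDensity (L := L) (hubAt δs 1) ε p) + ∫ p in D, prof p * mbDensity (L := L) (hubAt δs 1) ε p := hsplit.symm
      _ ≤ (2 / ρ₀ ^ 2) * (1 + δt ^ 2) * P δs + (512 * X * Osc / (ρO ^ 2 / 8)) * ((1 + δt ^ 2) * (1 + δt ^ 2) ^ (1 / 8 : ℝ)) * P δs := add_le_add hbox hdisc'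
      _ = _ := by ring
  -- the two-weight core layer
  have hΦ₁ : 0 ≤ Φ * (2 * Real.pi / b) ^ alpha L * (2 / ρ₀ ^ 2) := by positivity
  have hΦ₂ : 0 ≤ Φ * (2 * Real.pi / b) ^ alpha L * (512 * X * Osc / (ρO ^ 2 / 8)) := by positivity
  have H' : ∀ δt ∈ Ioi d, ∀ δs ∈ Icc δr (2 * δr), hubIntegral (L := L) (hubAt δt 1) ε b ≤
      (Φ * (2 * Real.pi / b) ^ alpha L * (2 / ρ₀ ^ 2) * (1 + δt ^ 2) +
        Φ * (2 * Real.pi / b) ^ alpha L * (512 * X * Osc / (ρO ^ 2 / 8)) * ((1 + δt ^ 2) * (1 + δt ^ 2) ^ (1 / 8 : ℝ))) * P δs + T := by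
    intro δt hδt δs hδs
    have h := H δt hδt δs hδs
    have h2 := hper δt hδt δs hδs
    have h3 : Φ * ((2 * Real.pi / b) ^ alpha L * ∫ p : ℝ × ℝ, ((1 + δt ^ 2) ^ 2 / (1 + (p.1 ^ 2 / (1 + p.1 ^ 2) + p.2 ^ 2 / (1 + p.2 ^ 2)) * (1 + δt ^ 2))) *
          mbDensity (L := L) (hubAt δs 1) ε p) ≤
        Φ * ((2 * Real.pi / b) ^ alpha L * (((2 / ρ₀ ^ 2) * (1 + δt ^ 2) + (512 * X * Osc / (ρO ^ 2 / 8)) * ((1 + δt ^ 2) * (1 + δt ^ 2) ^ (1 / 8 : ℝ))) * P δs)) :=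
      mul_le_mul_of_nonneg_left (mul_le_mul_of_nonneg_left h2 hG0) hΦ
    calc hubIntegral (L := L) (hubAt δt 1) ε b ≤ _ := h
      _ ≤ Φ * ((2 * Real.pi / b) ^ alpha L * (((2 / ρ₀ ^ 2) * (1 + δt ^ 2) + (512 * X * Osc / (ρO ^ 2 / 8)) * ((1 + δt ^ 2) * (1 + δt ^ 2) ^ (1 / 8 : ℝ))) * P δs)) + T :=
          add_le_add h3 le_rfl
      _ = _ := by ring
  have hI0 : ∀ δ ∈ Ioi d, 0 ≤ hubIntegral (L := L) (hubAt δ 1) ε b := fun δ _ => (hubIntegral_hubAt_le_mass (L := L) hb δ ε).1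
  have hS' : IntegrableOn (fun δ : ℝ => ((1 + δ ^ 2)⁻¹) ^ 2 * P δ) (Icc δr (2 * δr)) := by
    rw [hPdef]; exact (integrableOn_planeMass_hubCot (L := L) hε hτ hτ1).mono_set hshell
  have hlayer := core_le_shell_of_pointwise₂ (I := fun δ => hubIntegral (L := L) (hubAt δ 1) ε b) (P := P) hd hδr1 (by linarith : δr < 2 * δr)
    hΦ₁ hΦ₂ hT hI0 (fun δ _ => hP0 δ) H' hS'
  -- the shell plane mass against the bulk main term
  have hshellMain : coneConst * Real.pi * ∫ δ in Icc δr (2 * δr), ((1 + δ ^ 2)⁻¹) ^ 2 * P δ ≤ ∫ a in HubBulk τ, (∫ p : ℝ × ℝ, mbDensity (L := L) a ε p) ∂coneMeasure := by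
    rw [hPdef]; exact mbMain_ge_of_subset (L := L) hε hτ hτ1 hshell
  have hW : 0 < ((2 * δr) / (1 + (2 * δr) ^ 2) - δr / (1 + δr ^ 2) + (Real.arctan (2 * δr) - Real.arctan δr)) / 2 := by
    have h := integral_Icc_inv_one_add_sq_sq_ge hδr1 (by linarith : δr ≤ 2 * δr)
    rw [integral_Icc_inv_one_add_sq_sq (by linarith : δr ≤ 2 * δr)] at h
    have hlt : (2 * δr)⁻¹ ^ 3 < δr⁻¹ ^ 3 := by
      have h1 : (2 * δr)⁻¹ < δr⁻¹ := by rw [inv_lt_inv₀ (by positivity) hδr0]; linarith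
      exact pow_lt_pow_left₀ h1 (by positivity) (by norm_num)
    linarith
  have hd0 : 0 < d := by linarith
  have hcoef0 : 0 ≤ (Φ * (2 * Real.pi / b) ^ alpha L * (2 / ρ₀ ^ 2) * d⁻¹ +
      Φ * (2 * Real.pi / b) ^ alpha L * (512 * X * Osc / (ρO ^ 2 / 8)) * (2 * (4 / 3) * d ^ (-(3 / 4 : ℝ)))) /
      (((2 * δr) / (1 + (2 * δr) ^ 2) - δr / (1 + δr ^ 2) + (Real.arctan (2 * δr) - Real.arctan δr)) / 2) := by
    have : 0 ≤ d ^ (-(3 / 4 : ℝ)) := Real.rpow_nonneg hd0.le _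
    positivity
  have hB0 : 0 ≤ ∫ δ in Icc δr (2 * δr), ((1 + δ ^ 2)⁻¹) ^ 2 * P δ := setIntegral_nonneg measurableSet_Icc fun δ _ => mul_nonneg (by positivity) (hP0 δ)
  have hfin := mul_le_mul_of_nonneg_left hlayer hcc.le
  refine hfin.trans ?_
  rw [mul_add]
  refine add_le_add ?_ le_rfl
  have e : coneConst * Real.pi * ((Φ * (2 * Real.pi / b) ^ alpha L * (2 / ρ₀ ^ 2) * d⁻¹ +
        Φ * (2 * Real.pi / b) ^ alpha L * (512 * X * Osc / (ρO ^ 2 / 8)) * (2 * (4 / 3) * d ^ (-(3 / 4 : ℝ)))) /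
        (((2 * δr) / (1 + (2 * δr) ^ 2) - δr / (1 + δr ^ 2) + (Real.arctan (2 * δr) - Real.arctan δr)) / 2) *
        ∫ δ in Icc δr (2 * δr), ((1 + δ ^ 2)⁻¹) ^ 2 * P δ) =
      (Φ * (2 * Real.pi / b) ^ alpha L * (2 / ρ₀ ^ 2) * d⁻¹ +
        Φ * (2 * Real.pi / b) ^ alpha L * (512 * X * Osc / (ρO ^ 2 / 8)) * (2 * (4 / 3) * d ^ (-(3 / 4 : ℝ)))) /
        (((2 * δr) / (1 + (2 * δr) ^ 2) - δr / (1 + δr ^ 2) + (Real.arctan (2 * δr) - Real.arctan δr)) / 2) *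
        (coneConst * Real.pi * ∫ δ in Icc δr (2 * δr), ((1 + δ ^ 2)⁻¹) ^ 2 * P δ) := by ring
  rw [e]
  have e2 : (coneConst * Real.pi)⁻¹ * (∫ a in HubBulk τ, (∫ p : ℝ × ℝ, mbDensity (L := L) a ε p) ∂coneMeasure) * (coneConst * Real.pi) =
      ∫ a in HubBulk τ, (∫ p : ℝ × ℝ, mbDensity (L := L) a ε p) ∂coneMeasure := by
    rw [mul_comm, ← mul_assoc, mul_inv_cancel₀ hcc.ne', one_mul]
  rw [hXdef, hOscdef] at hcoef0 ⊢
  rw [mul_assoc _ ((coneConst * Real.pi)⁻¹ * _) (coneConst * Real.pi), e2]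
  exact mul_le_mul_of_nonneg_left hshellMain hcoef0

end Summit.QuantumFields.YangMills.Theorems.SwapVirialDeficit.SectorLaplace

end
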